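import Summits.QuantumAdvantage.QuantumAdvantage.Theorems.MobiusLadderLiouvilleNotPPolyOneTimePadDefs
import Summits.QuantumAdvantage.QuantumAdvantage.Theorems.MobiusLadderLiouvilleNotPPolyTwinKernel
import HarnessLib

/-!
# Crux `MobiusLadder.LiouvilleNotPPoly` (stmt-QuantumAdvantage-1389), line `SketchIdeator4`
(card `multiplicative-one-time-pad`): the KERNEL of the line, proved

Helper file of the checked skeleton `Cruxes/LiouvilleNotPPoly/Lines/SketchIdeator4.lean` (lead a1).
Everything here is sorry-free:

* the multiplicative one-time pad `λ(N) = λ(N r) λ(r)` (`pad_identity`), its oracle form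
  `λ(N) = -1 ↔ λ(N r) ≠ λ(r)` (`liouville_eq_neg_one_iff_mul_ne`, what `padOracle` decodes with), and
  the counting kernel (`card_filter_mul_mem_le`, `good_multipliers`: multiplication by `N ≠ 0` is
  injective, so a rare error set spoils few multipliers, uniformly in `N`);
* `errCount_self`, `rareErrorFamily_of_mem_PPoly` (the trivial direction of T1);
* **T1′, the ceiling** (registered stub `no_classUniform_corrector`): `flipAt p` — `λ` with the sign at
  one prime flipped — is completely multiplicative and `(1/p)`-close to `λ`, so no procedure uniform over
  completely multiplicative `±1` targets corrects error rate `1/p` to worst case (two-world argument at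
  the input `p q`);
* the decider read-back `decides_eval`, `liouvilleLang_not_mem_SIZE` (apex ⟹ no polynomial size bound
  decides `L_λ`, by the elementary cancellation `abs_sum_liouville_range_le` of the tree — no PNT), and
  the two compositions `liouvilleLang_not_mem_PPoly_of_apex : LiouvilleOrthogonalPPoly → L_λ ∉ P/poly`,
  `liouvilleLang_not_mem_PPoly_of_mildAvgHard : MildAvgHard c → L_λ ∉ P/poly` (each definitionally the
  crux, `crux_iff`).
-/

set_option linter.dupNamespace false -- D-0017: single-problem summit ⇒ `QuantumAdvantage.QuantumAdvantage` by design

noncomputable section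

namespace Summit.QuantumAdvantage.QuantumAdvantage.Theorems.LiouvilleNotPPoly.OneTimePad

open Literature.Computability.Complexity
open Literature.Probability.RandomGraphs.LowDegree (sgn sgn_true sgn_false)
open _root_.Computability Filter Finset Polynomial
open Summit.QuantumAdvantage.QuantumAdvantage.Theorems.MobiusLadder
open Summit.QuantumAdvantage.QuantumAdvantage.Theorems.LiouvilleOrthogonalTC0 (bits ofBits lamBit)

/-! ## The pad and the counting kernel -/

/-- `λ(r)² = 1` for `r ≠ 0`. [folklore] -/
theorem liouville_mul_self {r : ℕ} (hr : r ≠ 0) :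
    ArithmeticFunction.liouville r * ArithmeticFunction.liouville r = 1 := by
  rcases liouville_eq_one_or_eq_neg_one hr with h | h <;> simp [h]

/-- **The multiplicative one-time pad.** For every multiplier `r ≠ 0`, `λ(N) = λ(N·r)·λ(r)`. [folklore] -/
theorem pad_identity (N : ℕ) {r : ℕ} (hr : r ≠ 0) :
    ArithmeticFunction.liouville N =
      ArithmeticFunction.liouville (N * r) * ArithmeticFunction.liouville r := by
  rw [ArithmeticFunction.liouville_apply_mul, mul_assoc, liouville_mul_self hr, mul_one]

/-- **The pad, oracle form**: for `N, r ≠ 0`, `λ(N) = -1 ↔ λ(N r) ≠ λ(r)` — the identity the pad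
oracle `padOracle` decodes with. [folklore] -/
theorem liouville_eq_neg_one_iff_mul_ne {N r : ℕ} (hN : N ≠ 0) (hr : r ≠ 0) :
    ArithmeticFunction.liouville N = -1 ↔
      ArithmeticFunction.liouville (N * r) ≠ ArithmeticFunction.liouville r := by
  rw [pad_identity N hr]
  rcases liouville_eq_one_or_eq_neg_one (mul_ne_zero hN hr) with h | h <;>
    rcases liouville_eq_one_or_eq_neg_one hr with h' | h' <;> simp [h, h']

/-- **Counting kernel.** Multiplication by `N ≠ 0` is injective, so among any set `R` of multipliers
at most `#E` send `N·r` into a given (error) set `E`. [folklore] -/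
theorem card_filter_mul_mem_le {N : ℕ} (hN : N ≠ 0) (R E : Finset ℕ) :
    (R.filter fun r => N * r ∈ E).card ≤ E.card := by
  refine Finset.card_le_card_of_injOn (fun r => N * r) ?_ ?_
  · intro r hr
    exact (Finset.mem_filter.1 hr).2
  · intro a _ b _ hab
    exact Nat.eq_of_mul_eq_mul_left (Nat.pos_of_ne_zero hN) hab

/-- If the error set is at most a quarter of the multiplier pool, then for EVERY instance `N ≠ 0` at
least three quarters of the multipliers are good — uniformly in `N`. -/
theorem good_multipliers {N : ℕ} (hN : N ≠ 0) (R E : Finset ℕ) (hE : 4 * E.card ≤ R.card) :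
    4 * (R.filter fun r => N * r ∈ E).card ≤ R.card :=
  le_trans (Nat.mul_le_mul_left 4 (card_filter_mul_mem_le hN R E)) hE

/-- A language never disagrees with itself. -/
theorem errCount_self (L : Language Bool) (ℓ : ℕ) : errCount L L ℓ = 0 := by
  classical
  unfold errCount
  rw [Finset.card_eq_zero, Finset.filter_eq_empty_iff]
  intro w _ h
  exact h Iff.rfl

/-- Trivial direction of T1: an exact family is a rare-error family. -/
theorem rareErrorFamily_of_mem_PPoly (h : liouvilleLang ∈ PPoly) (ε : ℝ) : RareErrorFamily ε := by
  refine ⟨liouvilleLang, h, Filter.Eventually.of_forall fun ℓ => ?_⟩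
  rw [errCount_self, Nat.cast_zero]
  positivity

/-! ### T1′ — the ceiling: one flipped prime (PROVED) -/

/-- `flipAt p` is completely multiplicative (on nonzero arguments). -/
theorem flipAt_mul {p : ℕ} [Fact p.Prime] {a b : ℕ} (ha : a ≠ 0) (hb : b ≠ 0) :
    flipAt p (a * b) = flipAt p a * flipAt p b := by
  simp only [flipAt]
  rw [ArithmeticFunction.liouville_apply_mul, padicValNat.mul ha hb, pow_add]
  ring

/-- Off the multiples of `p`, `flipAt p = λ`. -/
theorem flipAt_of_not_dvd {p N : ℕ} (h : ¬ p ∣ N) : flipAt p N = ArithmeticFunction.liouville N := by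
  simp only [flipAt]
  rw [padicValNat.eq_zero_of_not_dvd h, pow_zero, mul_one]

/-- `flipAt p p = +1`: the flipped prime. -/
theorem flipAt_prime_self {p : ℕ} (hp : p.Prime) : flipAt p p = 1 := by
  haveI := Fact.mk hp
  simp only [flipAt]
  rw [padicValNat_self, liouville_prime hp]
  norm_num

/-- `λ(p q) = +1` for primes `p, q`. -/
theorem liouville_prime_mul_prime {p q : ℕ} (hp : p.Prime) (hq : q.Prime) :
    ArithmeticFunction.liouville (p * q) = 1 := by
  rw [ArithmeticFunction.liouville_apply_mul, liouville_prime hp, liouville_prime hq]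
  norm_num

/-- `flipAt p (p q) = -1` for distinct primes `p, q`. -/
theorem flipAt_prime_mul_prime {p q : ℕ} (hp : p.Prime) (hq : q.Prime) (hpq : p ≠ q) :
    flipAt p (p * q) = -1 := by
  haveI := Fact.mk hp
  rw [flipAt_mul hp.ne_zero hq.ne_zero, flipAt_prime_self hp, flipAt_of_not_dvd, liouville_prime hq]
  · norm_num
  · intro h
    exact hpq ((Nat.prime_dvd_prime_iff_eq hp hq).1 h)

/-- The disagreement set of `flipAt p` and `λ` below `X` lies inside the multiples of `p`. -/
theorem filter_flipAt_ne_subset (p X : ℕ) :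
    ((Finset.range X).filter fun N => flipAt p N ≠ ArithmeticFunction.liouville N) ⊆
      (Finset.range X).filter fun N => p ∣ N := by
  intro N hN
  rw [Finset.mem_filter] at hN ⊢
  refine ⟨hN.1, ?_⟩
  by_contra h
  exact hN.2 (flipAt_of_not_dvd h)

/-- There are at most `X / p + 1` multiples of `p` below `X`. [folklore] -/
theorem card_filter_dvd_range_le {p : ℕ} (hp : 0 < p) (X : ℕ) :
    ((Finset.range X).filter fun N => p ∣ N).card ≤ X / p + 1 := by
  calc ((Finset.range X).filter fun N => p ∣ N).card
      ≤ ((Finset.range (X / p + 1)).image fun k => p * k).card := by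
        apply Finset.card_le_card
        intro N hN
        rw [Finset.mem_filter, Finset.mem_range] at hN
        obtain ⟨k, rfl⟩ := hN.2
        rw [Finset.mem_image]
        refine ⟨k, Finset.mem_range.2 ?_, rfl⟩
        have hk : k ≤ X / p := by
          rw [Nat.le_div_iff_mul_le hp, mul_comm]
          exact hN.1.le
        omega
    _ ≤ (Finset.range (X / p + 1)).card := Finset.card_image_le
    _ = X / p + 1 := Finset.card_range _

/-- Every function is close to itself. -/
theorem closeAtRate_refl {δ : ℝ} (hδ : 0 ≤ δ) (f : ℕ → ℤ) : CloseAtRate δ f f := by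
  intro X
  have h : ((Finset.range X).filter fun N => f N ≠ f N) = ∅ :=
    Finset.filter_eq_empty_iff.2 fun _ _ h => h rfl
  rw [h, Finset.card_empty, Nat.cast_zero]
  have := mul_nonneg hδ (Nat.cast_nonneg (α := ℝ) X)
  linarith

/-- **The adversary is admissible:** `flipAt p` is `(1/p)`-close to `λ`. -/
theorem closeAtRate_flipAt {p : ℕ} (hp : p.Prime) :
    CloseAtRate (1 / p) (flipAt p) (fun N => ArithmeticFunction.liouville N) := by
  intro X
  have h1 := Finset.card_le_card (filter_flipAt_ne_subset p X)
  have h2 := card_filter_dvd_range_le hp.pos X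
  have h3 : ((X / p : ℕ) : ℝ) ≤ (X : ℝ) / p := Nat.cast_div_le
  have h12 : (((Finset.range X).filter fun N =>
      flipAt p N ≠ ArithmeticFunction.liouville N).card : ℝ) ≤ ((X / p : ℕ) : ℝ) + 1 := by
    exact_mod_cast h1.trans h2
  calc (((Finset.range X).filter fun N => flipAt p N ≠ ArithmeticFunction.liouville N).card : ℝ)
      ≤ ((X / p : ℕ) : ℝ) + 1 := h12
    _ ≤ 1 / (p : ℝ) * X + 1 := by rw [one_div_mul_eq_div]; linarith

/-- **T1′ — the ceiling (class form), PROVED.** For distinct primes `p, q` there is NO oracle procedure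
`R` — of any complexity — that computes every target `f ∈ {λ, flipAt p}` from every oracle `(1/p)`-close
to `f`: at the input `p·q` the world (target `λ`, oracle `flipAt p`) demands `+1` and the world
(target `flipAt p`, oracle `flipAt p`) demands `-1`, on identical data. -/
theorem no_classUniform_corrector {p q : ℕ} (hp : p.Prime) (hq : q.Prime) (hpq : p ≠ q) :
    ¬ ∃ R : (ℕ → ℤ) → ℕ → ℤ,
      ∀ f ∈ ({(fun N => ArithmeticFunction.liouville N), flipAt p} : Set (ℕ → ℤ)), ∀ O : ℕ → ℤ,
        CloseAtRate (1 / p) O f → ∀ N, R O N = f N := by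
  rintro ⟨R, hR⟩
  have h1 := hR (fun N => ArithmeticFunction.liouville N) (by simp) (flipAt p)
    (closeAtRate_flipAt hp) (p * q)
  have h2 := hR (flipAt p) (by simp) (flipAt p) (closeAtRate_refl (by positivity) _) (p * q)
  rw [liouville_prime_mul_prime hp hq] at h1
  rw [flipAt_prime_mul_prime hp hq hpq, h1] at h2
  norm_num at h2

/-- **STUB T1′ · `stub_ceiling` (registered) — the ceiling in closed form**: for all distinct primes
`p, q`, no oracle procedure computes every target in `{λ, flipAt p}` from every `(1/p)`-close oracle
(`no_classUniform_corrector`). Read with `p` an `m`-bit prime: black-box self-correction uniform over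
completely multiplicative `±1` targets cannot take error rate `2^{-m}` to worst case, whereas T1 takes
rate `2^{-ℓ^ε}` to worst case by padding — the `1/poly` level is not a black-box consequence of `X`. -/
theorem stub_ceiling : ∀ p q : ℕ, p.Prime → q.Prime → p ≠ q → ¬ ∃ R : (ℕ → ℤ) → ℕ → ℤ, ∀ f ∈ ({(fun N => ArithmeticFunction.liouville N), flipAt p} : Set (ℕ → ℤ)), ∀ O : ℕ → ℤ, CloseAtRate (1 / p) O f → ∀ N, R O N = f N :=
  fun _ _ hp hq hpq => no_classUniform_corrector hp hq hpq

/-! ### The decider read-back and the two compositions into the crux (PROVED) -/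

/-- A family deciding `L_λ`, at length `k+1`, outputs `[2^k ≤ N ∧ λ N = -1]` on the digits of
`N < 2^(k+1)` (encoding glue of the tree, `ofFn_testBit_mem_toLanguage_iff`). -/
theorem decides_eval {C : CircuitFamily} (hdec : C.Decides liouvilleLang) {k N : ℕ}
    (hN : N < 2 ^ (k + 1)) :
    (C (k + 1)).eval (bits (k + 1) N) =
      decide (2 ^ k ≤ N ∧ ArithmeticFunction.liouville N = -1) := by
  rw [show bits (k + 1) N = fun i : Fin (k + 1) => Nat.testBit N i from rfl, hdec.eval_eq]
  have hiff := ofFn_testBit_mem_toLanguage_iff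
    {N : ℕ | ArithmeticFunction.liouville N = -1} (k := k) hN
  simp only [Set.mem_setOf_eq] at hiff
  by_cases h : 2 ^ k ≤ N ∧ ArithmeticFunction.liouville N = -1
  · rw [decide_eq_true h]
    exact (Set.mem_iff_boolIndicator _ _).1 (hiff.2 h)
  · rw [decide_eq_false h]
    exact (Set.notMem_iff_boolIndicator _ _).1 fun hm => h (hiff.1 hm)

/-- **Apex ⟹ no polynomial size bound decides `L_λ`**: a deciding family has correlation
`2^(n-1) + ∑_{N<2^(n-1)} λ(N) ≥ 2^(n-2)` (elementary cancellation `abs_sum_liouville_range_le`,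
no PNT), contradicting the apex at `ε = 1/8`. -/
theorem liouvilleLang_not_mem_SIZE (H : LiouvilleOrthogonalPPoly) (p : Polynomial ℕ) :
    liouvilleLang ∉ SIZE (fun n => p.eval n) := by
  rintro ⟨C, hC, hdec⟩
  have hev := H p (1 / 8) (by norm_num)
  obtain ⟨n, hn3, hn⟩ := ((Filter.eventually_ge_atTop 3).and hev).exists
  obtain ⟨k, rfl⟩ : ∃ k, n = k + 3 := ⟨n - 3, by omega⟩
  have hb := hn (C (k + 3)) (hC _).1 (hC _).2
  have hpow3 : 2 ^ (k + 3) = 4 * 2 ^ k + 4 * 2 ^ k := by rw [pow_add]; ring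
  have heval : ∀ N : ℕ, N < 2 ^ (k + 3) →
      (C (k + 3)).eval (bits (k + 3) N) =
        decide (2 ^ (k + 2) ≤ N ∧ ArithmeticFunction.liouville N = -1) :=
    fun N hN => decides_eval hdec hN
  -- lower half: not codewords, the circuit rejects, the term is `λ(N)`
  have hlow : ∀ N ∈ Finset.range (4 * 2 ^ k),
      ((ArithmeticFunction.liouville N : ℤ) : ℝ) * sgn ((C (k + 3)).eval (bits (k + 3) N)) =
        ((ArithmeticFunction.liouville N : ℤ) : ℝ) := by
    intro N hN
    rw [Finset.mem_range] at hN
    rw [heval N (by omega)]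
    have hnot : ¬ (2 ^ (k + 2) ≤ N ∧ ArithmeticFunction.liouville N = -1) := fun h => by
      have := h.1
      rw [pow_add] at this
      omega
    rw [decide_eq_false hnot, sgn_false, mul_one]
  -- upper half: codewords, the circuit outputs `[λ N = -1]`, the term is `1`
  have hhigh : ∀ M ∈ Finset.range (4 * 2 ^ k),
      ((ArithmeticFunction.liouville (4 * 2 ^ k + M) : ℤ) : ℝ) *
          sgn ((C (k + 3)).eval (bits (k + 3) (4 * 2 ^ k + M))) = 1 := by
    intro M hM
    rw [Finset.mem_range] at hM
    rw [heval _ (by omega)]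
    have hle : 2 ^ (k + 2) ≤ 4 * 2 ^ k + M := by rw [pow_add]; omega
    have hne : 4 * 2 ^ k + M ≠ 0 := by positivity
    rcases liouville_eq_one_or_eq_neg_one hne with h1 | h1
    · have hnot : ¬ (2 ^ (k + 2) ≤ 4 * 2 ^ k + M ∧
          ArithmeticFunction.liouville (4 * 2 ^ k + M) = -1) := by
        rintro ⟨-, h⟩
        rw [h1] at h
        norm_num at h
      rw [decide_eq_false hnot, sgn_false, h1]
      simp
    · rw [decide_eq_true ⟨hle, h1⟩, sgn_true, h1]
      simp
  have hsum : corr (k + 3) (C (k + 3)) =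
      ∑ N ∈ Finset.range (4 * 2 ^ k), ((ArithmeticFunction.liouville N : ℤ) : ℝ) + 4 * 2 ^ k := by
    unfold corr
    rw [hpow3, Finset.sum_range_add, Finset.sum_congr rfl hlow, Finset.sum_congr rfl hhigh]
    simp
  have hT := abs_sum_liouville_range_le (2 ^ k)
  rw [hsum] at hb
  have h8 : (1 / 8 : ℝ) * (2 : ℝ) ^ (k + 3) = (2 : ℝ) ^ k := by
    rw [pow_add]
    ring
  rw [h8] at hb
  have hpos : (0 : ℝ) < (2 : ℝ) ^ k := by positivity
  have h1 := (abs_le.1 hb).2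
  have h2 := (abs_le.1 hT).1
  push_cast at h1 h2
  linarith

/-- **Composition 1 (PROVED): the apex gives `L_λ ∉ P/poly`** (definitionally the crux, `crux_iff`;
the by-name statement is `LiouvilleNotPPoly_of` below). `LiouvilleOrthogonalPPoly → X`. -/
theorem liouvilleLang_not_mem_PPoly_of_apex (H : LiouvilleOrthogonalPPoly) :
    liouvilleLang ∉ PPoly := by
  intro hmem
  simp only [PPoly, Set.mem_iUnion] at hmem
  obtain ⟨p, hp⟩ := hmem
  exact liouvilleLang_not_mem_SIZE H p hp

/-- An exact decider has no disagreement on the instances of any length `k+1`. -/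
theorem disagree_eq_zero_of_decides {C : CircuitFamily} (hdec : C.Decides liouvilleLang) (k : ℕ) :
    disagree (k + 1) (C (k + 1)) = 0 := by
  unfold disagree
  rw [Finset.card_eq_zero, Finset.filter_eq_empty_iff]
  intro N hN h
  rw [Finset.mem_Ico] at hN
  rw [Nat.add_sub_cancel] at hN
  apply h
  rw [decides_eval hdec hN.2]
  unfold lamBit
  by_cases hl : ArithmeticFunction.liouville N = -1
  · rw [decide_eq_true ⟨hN.1, hl⟩, decide_eq_true hl]
  · rw [decide_eq_false (fun h' => hl h'.2), decide_eq_false hl]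

/-- **Composition 2 (PROVED): the `1/poly` level gives `L_λ ∉ P/poly`** (definitionally the crux).
`MildAvgHard c → X` (an exact decider has `disagree = 0 < 2^{n-1}/n^c`). -/
theorem liouvilleLang_not_mem_PPoly_of_mildAvgHard {c : ℕ} (H : MildAvgHard c) :
    liouvilleLang ∉ PPoly := by
  intro hmem
  simp only [PPoly, Set.mem_iUnion] at hmem
  obtain ⟨p, C, hC, hdec⟩ := hmem
  have hev := H p
  obtain ⟨n, hn1, hn⟩ := ((Filter.eventually_ge_atTop 1).and hev).exists
  obtain ⟨k, rfl⟩ : ∃ k, n = k + 1 := ⟨n - 1, by omega⟩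
  have hb := hn (C (k + 1)) (hC _).1 (hC _).2
  rw [disagree_eq_zero_of_decides hdec k, Nat.cast_zero, mul_zero] at hb
  have hpos : (0 : ℝ) < (2 : ℝ) ^ (k + 1 - 1) := by positivity
  linarith

end Summit.QuantumAdvantage.QuantumAdvantage.Theorems.LiouvilleNotPPoly.OneTimePad

end
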